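import Literature.Analysis.FluidPDE.DriftHeatOscillation
import Literature.Analysis.FluidPDE.HarnackChainCover
import Literature.Analysis.FluidPDE.KNSSSwirlSupNonpos
import HarnessLib

/-!
# KNSS 2009, Lemma 2.1 (stability of the strong maximum principle) from the interior Harnack
# inequality

Analysis/FluidPDE proofs file. It proves the named fact
`Literature.Analysis.FluidPDE.KNSS2009_lemma21` (Koch–Nadirashvili–Seregin–Šverák, Acta Math. 203
(2009) = arXiv:0709.3599, Lemma 2.1, p. 5, vendored as printed — bounded domain `Ω`,
`Ω' ⊂⊂ Ω`, `K ⊂ Ω` compact, `τ > 0`, `δ` uniform in the drift bound — in `KNSSSwirlLiouville`)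
from the interior parabolic Harnack inequality `Literature.Analysis.FluidPDE.Lieberman1996_harnack_drift`
(Lieberman 1996, Theorem 6.27), for every finite-dimensional real inner product space `E`:

* `KNSS2009_lemma21_of_harnack : Lieberman1996_harnack_drift E → KNSS2009_lemma21 E`.

With the accepted `KNSS2009_swirl_sup_nonpos_of_lemma21` (`KNSSSwirlSupNonpos`) this reduces the
core of KNSS Theorem 5.3 (`KNSS2009_swirl_sup_nonpos`) to Lieberman's Theorem 6.27 alone
(`KNSS2009_swirl_sup_nonpos_of_harnack`), and Theorem 5.3 itself to Theorem 6.27, §4 and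
Theorem 5.2 (`KNSS2009_liouville_bound_C_over_r_of_harnack`).

**Status since the verdict clean-up of 2026-08-16: vacuous, superseded.** The hypothesis
`Lieberman1996_harnack_drift E` is **refuted** for nontrivial `E` (`not_Lieberman1996_harnack_drift`,
`ParabolicHarnackDriftRefutation`: its regions `Θ(R/2)` and `Q(R)` are adjacent in time — the
feature step 3 below exploits — misreading Lieberman's `Θ(R) = Q((y, s − 4R²), R)`, p. 122) and
is kept in `ParabolicHarnackDrift` only under `@[deprecated]`; the three theorems below are kept
unchanged as correct but vacuous implications, `linter.deprecated` off for each. Non-vacuous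
counterparts from the corrected, proved fact `Lieberman1996_harnack_drift_gap`
(`Lieberman1996_harnack_drift_gap_holds`, `ParabolicHarnackDriftGapProofs`): the `…_of_harnack_gap`
theorems of `KNSSLemma21OfHarnackGap`; unconditional: `KNSS2009_lemma21_holds` (`KNSSLemma21Proof`),
`KNSS2009_swirl_sup_nonpos_holds` (`KNSSThm53Discharge`).

## Proof

KNSS prove Lemma 2.1 by compactness ([LSU] interior regularity, strong maximum principle for a
limit). We give the direct quantitative argument behind that compactness, for `w = M − u ≥ 0`
(a solution of the same equation, `0 ≤ w ≤ 2M`): suppose `u(t, x) < M(1 − ε)` at some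
`x ∈ Ω'`, `τ < t < T`, i.e. `w(t, x) > εM`.

1. *Geometry* (`HarnackChainCover`): `Ω̄' ∪ K` lies in a compact connected `S ⊆ Ω` with a margin
   `m` (`B̄(z, m) ⊆ Ω` for `z ∈ S`); `r₀ = min(m/4, √τ/4)`.
2. *Regularity backwards in time* (`IsHarnackConstFor.osc_iterate`, from Harnack with constant
   `C ≥ 1` for radii `≤ r₀`): with `θ = 1 − 1/C`, `θᵏ < ε/4`, `ρ = r₀/4ᵏ`, the oscillation of `w`
   on the cylinder `Q((x, s'), ρ)`, `s' = min(T, t + ρ²/4)`, is `≤ θᵏ · 2M ≤ εM/2`, so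
   `w(t − ρ²/2, x) ≥ εM/2` — a definite step `G₀ = ρ²/2` back in time.
3. *Harnack chain forward* (`IsHarnackConstFor.chain`, `exists_uniform_chain`): from
   `(x, t − G₀)` to `(x_K, t₂)` for every `t₂ < T` close to `T`, along a chain of `≤ N` points of
   `S` with steps `< R_c = ρ/4` followed by steps at rest, `N_s + 1` steps in all
   (`N_s = N + 2 + ⌈T/R_c²⌉`), with equal small lags and a last lag `≈ R_c²` whose cylinder is
   topped at `(T + t₂)/2 ≤ T` (the Harnack regions `Θ(R/2)` and `Q(R)` of Theorem 6.27 are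
   adjacent in time, so intermediate lags may be arbitrarily small): `εM/2 ≤ C^{N_s+1} w(t₂, x_K)`.
4. Letting `t₂ → T` (`w(·, x_K)` is Lipschitz near `T`) gives `w(T, x_K) ≥ εM/(2C^{N_s+1})` for
   every `x_K ∈ K`, contradicting `u(T, x_K) ≥ M(1 − δ)` for `δ = ε/(4 C^{N_s+1})` — a `δ`
   depending on `Ω, Ω', K, T, A, τ, ε` only.

## References

* G. Koch, N. Nadirashvili, G. Seregin, V. Šverák, *Liouville theorems for the Navier–Stokes
  equations and applications*, Acta Math. 203 (2009) = arXiv:0709.3599, Lemma 2.1 (p. 5).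
  [KochNadirashviliSereginSverak2009]
* G. M. Lieberman, *Second Order Parabolic Differential Equations*, World Scientific (1996),
  Ch. VI, Theorems 6.25, 6.27, 6.28. [Lieberman1996]
-/

noncomputable section

open MeasureTheory Set Function Metric InnerProductSpace
open scoped Laplacian

namespace Literature.Analysis.FluidPDE

section Lemma21

variable {E : Type*} [NormedAddCommGroup E] [InnerProductSpace ℝ E] [FiniteDimensional ℝ E]
  [MeasurableSpace E]

-- names the `@[deprecated]` record `Lieberman1996_harnack_drift` of `ParabolicHarnackDrift.lean` on purpose: a (now
-- vacuous) consumer kept unchanged (verdict clean-up 2026-08-16); REMOVE-WHEN the record is deleted there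
set_option linter.deprecated false in
/-- **KNSS 2009, Lemma 2.1, from the interior Harnack inequality** (Koch–Nadirashvili–Seregin–
Šverák 2009, Lemma 2.1, p. 5, as vendored in `KNSS2009_lemma21`; the interior regularity "[LSU]"
of the printed compactness proof enters through Lieberman 1996, Theorem 6.27,
`Lieberman1996_harnack_drift`, via oscillation decay backwards in time and a Harnack chain; see
the module docstring). (Vacuous for nontrivial `E` since 2026-08-16: `hH` is the deprecated fact
refuted by `not_Lieberman1996_harnack_drift`; use `KNSS2009_lemma21_of_harnack_gap` or the
unconditional `KNSS2009_lemma21_holds`, see the module docstring.)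
[cite: KochNadirashviliSereginSverak2009, Lemma 2.1 (arXiv p. 5)] -/
theorem KNSS2009_lemma21_of_harnack (hH : Lieberman1996_harnack_drift E) :
    KNSS2009_lemma21 E := by
  intro Ω Ω' K T τ A ε hΩo hΩb hΩc hΩ'Ω hKc hKΩ hτ hε
  -- the case `K = ∅` is vacuous
  rcases K.eq_empty_or_nonempty with hKe | hKne
  · refine ⟨1, one_pos, ?_⟩
    intro a u M _ _ _ _ _ _ _ _ hK'
    obtain ⟨x, hx, -⟩ := hK'
    rw [hKe] at hx
    exact absurd hx (notMem_empty x)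
  -- Step 1: geometry — a compact connected envelope of `Ω̄' ∪ K` in `Ω`, a margin, `r₀`
  have hS₀c : IsCompact (closure Ω' ∪ K) :=
    (Metric.isCompact_of_isClosed_isBounded isClosed_closure (hΩb.subset hΩ'Ω)).union hKc
  obtain ⟨S, hSc, hSconn, hS₀S, hSΩ⟩ := exists_isCompact_isConnected_superset hΩo hΩc hS₀c
    (union_subset hΩ'Ω hKΩ) (hKne.mono subset_union_right)
  obtain ⟨m, hm, hmΩ⟩ := hSc.exists_cthickening_subset_open hΩo hSΩ
  have hball : ∀ z ∈ S, ∀ r ≤ m, closedBall z r ⊆ Ω := fun z hz r hr =>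
    ((closedBall_subset_closedBall hr).trans (closedBall_subset_cthickening hz m)).trans hmΩ
  obtain ⟨r₀, hr₀⟩ : ∃ r₀ : ℝ, r₀ = min (m / 4) (Real.sqrt τ / 4) := ⟨_, rfl⟩
  have hr₀pos : 0 < r₀ := by
    rw [hr₀]; exact lt_min (by positivity) (by positivity)
  have hr₀m : 4 * r₀ ≤ m := by
    have : r₀ ≤ m / 4 := by rw [hr₀]; exact min_le_left _ _
    linarith
  have hr₀τ : 16 * r₀ ^ 2 ≤ τ := by
    have h1 : r₀ ≤ Real.sqrt τ / 4 := by rw [hr₀]; exact min_le_right _ _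
    have h2 : (4 * r₀) ^ 2 ≤ Real.sqrt τ ^ 2 :=
      pow_le_pow_left₀ (by positivity) (by linarith) 2
    rw [Real.sq_sqrt hτ.le] at h2
    have h3 : (4 * r₀) ^ 2 = 16 * r₀ ^ 2 := by ring
    linarith
  -- Step 2: the Harnack constant, the contraction factor `θ`, the depth `k`
  obtain ⟨C, hC1, hC⟩ := hH.exists_const A hr₀pos
  have hCpos : 0 < C := by linarith
  obtain ⟨θ, hθ⟩ : ∃ θ : ℝ, θ = 1 - 1 / C := ⟨_, rfl⟩
  have hθ0 : 0 ≤ θ := by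
    have : 1 / C ≤ 1 := by rw [div_le_one hCpos]; exact hC1
    rw [hθ]; linarith
  have hθ1 : θ < 1 := by
    have : 0 < 1 / C := by positivity
    rw [hθ]; linarith
  obtain ⟨k, hk⟩ := exists_pow_lt_of_lt_one (show 0 < ε / 4 by positivity) hθ1
  -- the scales `ρ = r₀/4ᵏ`, `R_c = ρ/4`
  obtain ⟨ρ, hρ⟩ : ∃ ρ : ℝ, ρ = r₀ / 4 ^ k := ⟨_, rfl⟩
  have hρpos : 0 < ρ := by rw [hρ]; positivity
  have hρle : ρ ≤ r₀ := by
    rw [hρ, div_le_iff₀ (by positivity)]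
    have : (1 : ℝ) ≤ 4 ^ k := one_le_pow₀ (by norm_num)
    nlinarith
  obtain ⟨Rc, hRc⟩ : ∃ Rc : ℝ, Rc = ρ / 4 := ⟨_, rfl⟩
  have hRcpos : 0 < Rc := by rw [hRc]; positivity
  have hRcρ : 4 * Rc = ρ := by rw [hRc]; ring
  have h16 : 16 * Rc ^ 2 = ρ ^ 2 := by rw [← hRcρ]; ring
  have hRcr₀ : Rc ≤ r₀ := by linarith
  have hRcm : 4 * Rc ≤ m := by linarith
  have hRc2 : 0 < Rc ^ 2 := by positivity
  have hρ2 : 0 < ρ ^ 2 := by positivity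
  have hρr₀2 : ρ ^ 2 ≤ r₀ ^ 2 := pow_le_pow_left₀ hρpos.le hρle 2
  have hRcr₀2 : Rc ^ 2 ≤ r₀ ^ 2 := pow_le_pow_left₀ hRcpos.le hRcr₀ 2
  -- uniform chains in `S` at scale `R_c`, the number of steps, and `δ`
  obtain ⟨N, hN⟩ := exists_uniform_chain hSc hSconn.isPreconnected hRcpos
  obtain ⟨Ns, hNs⟩ : ∃ Ns : ℕ, Ns = N + 2 + ⌈T / Rc ^ 2⌉₊ := ⟨_, rfl⟩
  have hNs2 : (2 : ℝ) ≤ Ns := by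
    have : 2 ≤ Ns := by omega
    exact_mod_cast this
  have hNsT : T ≤ Ns * Rc ^ 2 := by
    have h1 : T / Rc ^ 2 ≤ ⌈T / Rc ^ 2⌉₊ := Nat.le_ceil _
    have h2 : (⌈T / Rc ^ 2⌉₊ : ℝ) ≤ Ns := by
      have : ⌈T / Rc ^ 2⌉₊ ≤ Ns := by omega
      exact_mod_cast this
    have h3 : T / Rc ^ 2 ≤ Ns := h1.trans h2
    rwa [div_le_iff₀ hRc2] at h3
  obtain ⟨CN, hCN⟩ : ∃ CN : ℝ, CN = C ^ (Ns + 1) := ⟨_, rfl⟩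
  have hCN1 : 1 ≤ CN := by rw [hCN]; exact one_le_pow₀ hC1
  have hCNpos : 0 < CN := by linarith only [hCN1]
  refine ⟨ε / (4 * CN), by positivity, ?_⟩
  -- the solution
  intro a u M ham haA hu2 hDu hΔu hequ hM huM hnear t ht x hx
  obtain ⟨xK, hxK, hnear⟩ := hnear
  by_contra hlt
  rw [not_le] at hlt
  -- `w = M − u ≥ 0` solves the same equation
  set w : ℝ → E → ℝ := fun s z => -u s z + M with hwdef
  have hw : IsDriftHeatSolutionOn a w A (Ioc 0 T) Ω :=
    (isDriftHeatSolutionOn_Ioc_of_hyps ham haA hu2 hDu hΔu hequ).neg.add_const hΩo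
      ordConnected_Ioc M
  have hwbd : ∀ s ∈ Ioc 0 T, ∀ z ∈ Ω, 0 ≤ w s z ∧ w s z ≤ 2 * M := by
    intro s hs z hz
    have h := abs_le.1 (huM s hs z hz)
    simp only [hwdef]
    constructor <;> linarith only [h.1, h.2]
  have hw0 : ∀ s ∈ Ioc 0 T, ∀ z ∈ Ω, 0 ≤ w s z := fun s hs z hz => (hwbd s hs z hz).1
  have hwtx : ε * M < w t x := by
    simp only [hwdef]; linarith only [hlt]
  have htT : t < T := ht.2
  have hτt : τ < t := ht.1
  have hxS : x ∈ S := hS₀S (Or.inl (subset_closure hx))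
  have hxKS : xK ∈ S := hS₀S (Or.inr hxK)
  have hxKΩ : xK ∈ Ω := hKΩ hxK
  -- Step 3: a definite step back in time: `w(t − ρ²/2, x) ≥ εM/2`
  obtain ⟨t₁, ht₁⟩ : ∃ t₁ : ℝ, t₁ = t - ρ ^ 2 / 2 := ⟨_, rfl⟩
  have ht₁t : t₁ < t := by rw [ht₁]; linarith only [hρ2]
  have ht₁pos : 16 * Rc ^ 2 < t₁ := by
    rw [ht₁]; linarith only [h16, hρr₀2, hr₀τ, hτt, hτ]
  have hback : ε * M / 2 ≤ w t₁ x := by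
    obtain ⟨s', hs'⟩ : ∃ s' : ℝ, s' = min T (t + ρ ^ 2 / 4) := ⟨_, rfl⟩
    have hs'T : s' ≤ T := by rw [hs']; exact min_le_left _ _
    have hs't : t < s' := by rw [hs']; exact lt_min htT (by linarith only [hρ2])
    have hs'le : s' ≤ t + ρ ^ 2 / 4 := by rw [hs']; exact min_le_right _ _
    have hB : closedBall x r₀ ⊆ Ω := hball x hxS r₀ (by linarith only [hr₀m, hr₀pos])
    have hs'r : r₀ ^ 2 < s' := by nlinarith only [hr₀τ, hτt, hs't, hr₀pos]
    have htQ : t ∈ Ioo (s' - (r₀ / 4 ^ k) ^ 2) s' :=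
      ⟨by rw [← hρ]; linarith only [hs'le, hρ2], hs't⟩
    have ht₁Q : t₁ ∈ Ioo (s' - (r₀ / 4 ^ k) ^ 2) s' :=
      ⟨by rw [← hρ, ht₁]; linarith only [hs'le, hρ2], by linarith only [ht₁t, hs't]⟩
    have hxB : x ∈ ball x (r₀ / 4 ^ k) := mem_ball_self (by rw [← hρ]; exact hρpos)
    have hosc := hC.osc_iterate hC1 hΩo hw hwbd hr₀pos le_rfl hB hs'r hs'T k htQ hxB ht₁Q hxB
    rw [← hθ] at hosc
    have h2 : θ ^ k * (2 * M - 0) ≤ ε / 4 * (2 * M) := by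
      rw [sub_zero]
      exact mul_le_mul_of_nonneg_right hk.le (by linarith only [hM])
    linarith only [hosc, h2, hwtx]
  -- Step 4: the Harnack chain from `(x, t₁)` to `(x_K, t₂)` for `t₂` close to `T`
  have hchain : ∀ t₂ ∈ Ioo (max t (T - Rc ^ 2 / 4)) T, ε * M / 2 ≤ CN * w t₂ xK := by
    intro t₂ ht₂
    have ht₂t : t < t₂ := lt_of_le_of_lt (le_max_left _ _) ht₂.1
    have ht₂T' : T - Rc ^ 2 / 4 < t₂ := lt_of_le_of_lt (le_max_right _ _) ht₂.1
    have ht₂T : t₂ < T := ht₂.2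
    -- the chain of points, padded at `x_K`
    obtain ⟨L, hLN, z, hz0, hzL, hzS, hzd⟩ := hN x hxS xK hxKS
    set Z : ℕ → E := fun i => if i ≤ L then z i else xK with hZ
    have hZS : ∀ i, Z i ∈ S := by
      intro i
      by_cases hi : i ≤ L
      · simp only [hZ, hi, if_true]; exact hzS i hi
      · simp only [hZ, hi, if_false]; exact hxKS
    have hZ0 : Z 0 = x := by simp [hZ, hz0]
    have hZN : Z (Ns + 1) = xK := by
      have : ¬ (Ns + 1 ≤ L) := by omega
      simp [hZ, this]
    -- the schedule
    obtain ⟨η₂, hη₂⟩ : ∃ η₂ : ℝ, η₂ = min ((T - t₂) / 2) (Rc ^ 2 / 16) := ⟨_, rfl⟩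
    have hη₂pos : 0 < η₂ := by
      rw [hη₂]; exact lt_min (by linarith only [ht₂T]) (by positivity)
    have hη₂le1 : η₂ ≤ (T - t₂) / 2 := by rw [hη₂]; exact min_le_left _ _
    have hη₂le2 : η₂ ≤ Rc ^ 2 / 16 := by rw [hη₂]; exact min_le_right _ _
    obtain ⟨gl, hgl⟩ : ∃ gl : ℝ, gl = Rc ^ 2 + η₂ := ⟨_, rfl⟩
    have hNspos : (0 : ℝ) < Ns := by linarith only [hNs2]
    obtain ⟨g, hg⟩ : ∃ g : ℝ, g = (t₂ - t₁ - gl) / Ns := ⟨_, rfl⟩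
    have hgN : (Ns : ℝ) * g = t₂ - t₁ - gl := by
      rw [hg]; field_simp
    have hbudget : 8 * Rc ^ 2 < t₂ - t₁ := by rw [ht₁]; linarith only [h16, ht₂t]
    have hgpos : 0 < g := by
      rw [hg]
      refine div_pos ?_ hNspos
      rw [hgl]; linarith only [hbudget, hη₂le2, hRc2]
    have hgle : g ≤ Rc ^ 2 := by
      rw [hg, div_le_iff₀ hNspos]
      have h1 : t₂ - t₁ ≤ T := by linarith only [ht₁pos, hRc2, ht₂T]
      have h2 : 0 ≤ gl := by rw [hgl]; positivity
      linarith only [h1, hNsT, h2]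
    set σ : ℕ → ℝ := fun i => if i ≤ Ns then t₁ + i * g else t₂ with hσ
    have hσ0 : σ 0 = t₁ := by simp [hσ]
    have hσN : σ (Ns + 1) = t₂ := by
      have : ¬ (Ns + 1 ≤ Ns) := by omega
      simp [hσ, this]
    have hσreg : ∀ i, i ≤ Ns → σ i = t₁ + i * g := fun i hi => by simp [hσ, hi]
    -- the chain inequality
    have hch := hC.chain hCpos.le hΩo hw hw0 hRcpos hRcr₀ Z σ (Ns + 1) ?_ ?_ ?_
    · rw [hσ0, hZ0, hσN, hZN, ← hCN] at hch
      exact hback.trans hch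
    · -- consecutive points are `R_c`-close
      intro i hi
      by_cases hiL : i + 1 ≤ L
      · have hi' : i ≤ L := by omega
        simp only [hZ, hiL, hi', if_true]
        rw [dist_comm]; exact hzd i (by omega)
      · by_cases hi' : i ≤ L
        · have hieq : i = L := by omega
          simp only [hZ, hiL, hi', if_false, if_true]
          rw [hieq, hzL, dist_self]; exact hRcpos
        · simp only [hZ, hiL, hi', if_false, dist_self]; exact hRcpos
    · -- margins
      intro i _
      exact hball (Z i) (hZS i) (4 * Rc) hRcm
    · -- the tops of the Harnack cylinders
      intro i hi
      by_cases hil : i < Ns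
      · -- a regular step: lag `g`, top `σ i + R_c² + g/5`
        have hσi : σ i = t₁ + i * g := hσreg i hil.le
        have hσi1' : σ (i + 1) = σ i + g := by
          rw [hσreg (i + 1) (by omega), hσi]; push_cast; ring
        have hile : (i : ℝ) + 1 ≤ Ns := by
          have : i + 1 ≤ Ns := by omega
          exact_mod_cast this
        have hi0 : (0 : ℝ) ≤ i := Nat.cast_nonneg i
        have hσi_ge : t₁ ≤ σ i := by
          have := mul_nonneg hi0 hgpos.le
          rw [hσi]; linarith only [this]
        have hσi_le : σ i ≤ t₁ + (Ns - 1) * g := by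
          have := mul_le_mul_of_nonneg_right (show (i : ℝ) ≤ Ns - 1 by linarith only [hile])
            hgpos.le
          rw [hσi]; linarith only [this]
        have hsum : t₁ + (Ns : ℝ) * g = t₂ - (Rc ^ 2 + η₂) := by
          rw [← hgl]; linarith only [hgN]
        refine ⟨σ i + Rc ^ 2 + g / 5, by linarith only [ht₁pos, hσi_ge, hRc2, hgpos],
          by linarith only [hσi_le, hsum, hη₂pos, hgpos, ht₂T], ?_, ?_⟩
        · constructor <;> linarith only [hgle, hRc2, hgpos]
        · rw [hσi1']; constructor <;> linarith only [hgle, hRc2, hgpos]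
      · -- the last step: from `t₂ − g_last` to `t₂`, top `(T + t₂)/2`
        have hieq : i = Ns := by omega
        have hσi : σ i = t₂ - gl := by
          rw [hσreg i (by omega), hieq]; linarith only [hgN]
        have hσi1 : σ (i + 1) = t₂ := by rw [hieq]; exact hσN
        refine ⟨(T + t₂) / 2, by linarith only [hRcr₀2, hr₀τ, hτt, ht₂t, ht₂T],
          by linarith only [ht₂T], ?_, ?_⟩
        · rw [hσi, hgl]; constructor <;> linarith only [ht₂T', hη₂le2, hη₂pos, ht₂T, hRc2]
        · rw [hσi1]; constructor <;> linarith only [ht₂T', ht₂T, hRc2]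
  -- Step 5: let `t₂ → T` (time-Lipschitz bound at `x_K`)
  have hTpos : 0 < T := by linarith only [hτ, hτt, htT]
  have hT2 : Icc (T / 2) T ⊆ Ioc 0 T := fun s hs => ⟨by linarith only [hs.1, hTpos], hs.2⟩
  obtain ⟨Lip, hLip⟩ := hw.exists_abs_sub_le hT2 isCompact_singleton (singleton_subset_iff.2 hxKΩ)
  have hclaim : ε * M / 2 ≤ CN * w T xK := by
    by_contra hcl
    rw [not_le] at hcl
    obtain ⟨gap, hgap⟩ : ∃ gap : ℝ, gap = ε * M / 2 - CN * w T xK := ⟨_, rfl⟩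
    have hgap0 : 0 < gap := by rw [hgap]; linarith only [hcl]
    -- a time `t₂` close to `T`
    obtain ⟨ι, hι⟩ : ∃ ι : ℝ, ι = min (min ((T - t) / 2) (Rc ^ 2 / 8))
      (min (T / 4) (gap / (2 * CN * (|Lip| + 1)))) := ⟨_, rfl⟩
    have hιpos : 0 < ι := by
      rw [hι]
      exact lt_min (lt_min (by linarith only [htT]) (by positivity))
        (lt_min (by linarith only [hTpos]) (by positivity))
    have hι1 : ι ≤ (T - t) / 2 := by rw [hι]; exact (min_le_left _ _).trans (min_le_left _ _)
    have hι2 : ι ≤ Rc ^ 2 / 8 := by rw [hι]; exact (min_le_left _ _).trans (min_le_right _ _)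
    have hι3 : ι ≤ T / 4 := by rw [hι]; exact (min_le_right _ _).trans (min_le_left _ _)
    have hι4 : ι ≤ gap / (2 * CN * (|Lip| + 1)) := by
      rw [hι]; exact (min_le_right _ _).trans (min_le_right _ _)
    have ht₂mem : T - ι ∈ Ioo (max t (T - Rc ^ 2 / 4)) T :=
      ⟨max_lt (by linarith only [hι1, htT]) (by linarith only [hι2, hRc2]),
        by linarith only [hιpos]⟩
    have h1 := hchain (T - ι) ht₂mem
    have h2 : |w T xK - w (T - ι) xK| ≤ Lip * |T - (T - ι)| :=
      hLip xK (mem_singleton xK) (T - ι) ⟨by linarith only [hι3, hTpos], by linarith only [hιpos]⟩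
        T ⟨by linarith only [hTpos], le_rfl⟩
    rw [show T - (T - ι) = ι by ring, abs_of_pos hιpos] at h2
    have h4 : Lip * ι ≤ |Lip| * ι := mul_le_mul_of_nonneg_right (le_abs_self _) hιpos.le
    have h3 : w (T - ι) xK ≤ w T xK + |Lip| * ι := by
      linarith only [(abs_le.1 (h2.trans h4)).1]
    have h5 : CN * (|Lip| * ι) ≤ gap / 2 := by
      have hden : 0 < 2 * CN * (|Lip| + 1) := by positivity
      have h6 : |Lip| * ι ≤ |Lip| * (gap / (2 * CN * (|Lip| + 1))) :=
        mul_le_mul_of_nonneg_left hι4 (abs_nonneg _)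
      have h7 : CN * (|Lip| * (gap / (2 * CN * (|Lip| + 1)))) ≤ gap / 2 := by
        rw [show CN * (|Lip| * (gap / (2 * CN * (|Lip| + 1)))) =
          gap / 2 * (CN * |Lip| / (CN * (|Lip| + 1))) by field_simp]
        have h8 : CN * |Lip| / (CN * (|Lip| + 1)) ≤ 1 := by
          rw [div_le_one (by positivity)]; nlinarith only [abs_nonneg Lip, hCNpos]
        calc gap / 2 * (CN * |Lip| / (CN * (|Lip| + 1))) ≤ gap / 2 * 1 :=
              mul_le_mul_of_nonneg_left h8 (by linarith only [hgap0])
          _ = gap / 2 := mul_one _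
      exact (mul_le_mul_of_nonneg_left h6 hCNpos.le).trans h7
    have h9 : CN * w (T - ι) xK ≤ CN * w T xK + CN * (|Lip| * ι) := by
      have := mul_le_mul_of_nonneg_left h3 hCNpos.le
      linarith only [this]
    linarith only [h1, h9, h5, hgap, hcl]
  -- Step 6: contradiction with `u(T, x_K) ≥ M(1 − δ)`
  have hwT : w T xK ≤ ε / (4 * CN) * M := by
    simp only [hwdef]
    have h1 : M * (1 - ε / (4 * CN)) ≤ u T xK := hnear
    have h2 : M * (1 - ε / (4 * CN)) = M - ε / (4 * CN) * M := by ring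
    linarith only [h1, h2]
  have h10 : CN * w T xK ≤ ε * M / 4 := by
    calc CN * w T xK ≤ CN * (ε / (4 * CN) * M) := mul_le_mul_of_nonneg_left hwT hCNpos.le
      _ = ε * M / 4 := by field_simp
  have hεM : 0 < ε * M := mul_pos hε hM
  linarith only [hclaim, h10, hεM]

-- names the `@[deprecated]` record `Lieberman1996_harnack_drift` on purpose (vacuous consumer kept unchanged, verdict
-- clean-up 2026-08-16); REMOVE-WHEN the record is deleted from `ParabolicHarnackDrift.lean`
set_option linter.deprecated false in
/-- **The core of KNSS 2009, Theorem 5.3, from Lieberman's interior Harnack inequality alone**: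
composing `KNSS2009_lemma21_of_harnack` with the accepted reduction
`KNSS2009_swirl_sup_nonpos_of_lemma21` (`KNSSSwirlSupNonpos`), the Liouville statement
`KNSS2009_swirl_sup_nonpos` for the swirl equation (5.10) — a bounded axisymmetric ancient
solution `f` of `fₜ + u·∇f = Δf − (2/r)∂ᵣf` with `|u| ≤ C/r`, `f = 0` on the axis, is `≤ 0` —
follows from `Lieberman1996_harnack_drift` on `ℝ³`. (Vacuous since 2026-08-16: the hypothesis is
the deprecated fact refuted by `not_Lieberman1996_harnack_drift`; use
`KNSS2009_swirl_sup_nonpos_of_harnack_gap` or the unconditional `KNSS2009_swirl_sup_nonpos_holds`,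
see the module docstring.) [cite: KochNadirashviliSereginSverak2009, proof of Thm 5.3 (arXiv p. 10)] -/
theorem KNSS2009_swirl_sup_nonpos_of_harnack
    (hH : Lieberman1996_harnack_drift (EuclideanSpace ℝ (Fin 3))) :
    KNSS2009_swirl_sup_nonpos :=
  KNSS2009_swirl_sup_nonpos_of_lemma21 (KNSS2009_lemma21_of_harnack hH)

-- names the `@[deprecated]` record `Lieberman1996_harnack_drift` on purpose (vacuous consumer kept unchanged, verdict
-- clean-up 2026-08-16); REMOVE-WHEN the record is deleted from `ParabolicHarnackDrift.lean`
set_option linter.deprecated false in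
/-- **KNSS 2009, Theorem 5.3 from the printed inputs, with Lemma 2.1 discharged to the Harnack
inequality**: the Liouville theorem for bounded weak ancient axisymmetric solutions with
`|u| ≤ C/r` (`KNSS2009_liouville_bound_C_over_r`) follows from Lieberman's Theorem 6.27
(`Lieberman1996_harnack_drift`), the §4 regularity / swirl-equation fact
(`KNSS2009_regularity_axisymmetric_swirl`) and Theorem 5.2
(`KNSS2009_liouville_axisymmetric_no_swirl`). (Vacuous since 2026-08-16: the hypothesis `hH` is
the deprecated fact refuted by `not_Lieberman1996_harnack_drift`; use
`KNSS2009_liouville_bound_C_over_r_of_harnack_gap`, see the module docstring.)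
[cite: KochNadirashviliSereginSverak2009, Thm 5.3 (arXiv p. 10)] -/
theorem KNSS2009_liouville_bound_C_over_r_of_harnack
    (hH : Lieberman1996_harnack_drift (EuclideanSpace ℝ (Fin 3)))
    (hreg : KNSS2009_regularity_axisymmetric_swirl)
    (h52 : KNSS2009_liouville_axisymmetric_no_swirl) : KNSS2009_liouville_bound_C_over_r :=
  KNSS2009_liouville_bound_C_over_r_of_lemma21 (KNSS2009_lemma21_of_harnack hH) hreg h52

end Lemma21

end Literature.Analysis.FluidPDE

end
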